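import Summits.AtomisticToContinuum.HydrodynamicLimit.Theses.BoxDissipativeWeakStrong
import Summits.AtomisticToContinuum.HydrodynamicLimit.Theorems.BoxDissipativeWeakStrongFluxClosureOfParts

/-!
# Skeleton for crux `FluxClosure` — route BoxDissipativeWeakStrong, item stmt-AtomisticToContinuum-9902
# line `birth`/`registered` (kinetic/collisional split, exact pathwise balance as the seam) — LEAD r7 (continuation lead c3):
# everything but K, V LANDED; the crux, K and V PROVED IN GLOBAL EQUILIBRIUM (rung 0); the STATIC half of K PROVED FOR
# GENERAL LOCAL GIBBS DATA (rung 0.5); L¹ ⟸ in-probability PROVED; MD falsifier of D/K/V out of equilibrium RUNNING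

Lead revision r8 = r6 + the c3 landings (continuation lead prover-line-stmt-AtomisticToContinuum-9902-c3-0, 2026-08-17): stubs and
composition IDENTICAL to r3–r7 (`FluxClosure_of := FluxClosureGlue.stub_fluxClosureOfLimitStubs stub_kineticIsotropy
stub_collisionalVirial`, glue landed p150403).

c3 ENTROPY LINE FOR K (namespace `…Theorems.FluxClosureEnt`, files `Theorems/BoxDissipativeWeakStrongFluxClosureEnt*.lean`, all LANDED):
* HEADLINE `FluxClosureEnt.kineticIsotropy_of_entropicLE` (p170956): stub K's conclusion — every flow family, kinetic window, τ < T,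
  smooth w — FOLLOWS from Yau-type relative-entropy local equilibrium with FREE jointly continuous parameters
  (`sup_{t≤τ} H((Φ_t)_*P_N ‖ localGibbsMeasure σ a_t u_t θ_t N) ≤ (N+1)h_N`, `h_N → 0`); = H2 `kineticIsotropy_of_relEntropy` (p170225,
  entropy inequality slice by slice along the flow) ∘ H1 `kinEntry_expMoment_localGibbs` (speed-(N+1) exponential moment of the
  K-integrand under an arbitrary local Gibbs law: H1b p170864 ∘ H1a2 p170901 ∘ H1a1 p170560, with S1 p169259, S2 p169306, Ga p169700,
  Gc p169983). So K ≤ the standard entropy form of local equilibrium (OVY93's estimate, which needs noise), parameters unidentified.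

c3 (rung 0.5, the static half of stub K for GENERAL data; namespace `…Theorems.FluxClosureEq.G1/G2`):
* G1 `FluxClosureEq.G1.kinStatic_lintegral_localGibbs_general_le` (p167410, `Theorems/…FluxClosureKinStaticGeneral.lean`) —
  Gaussian statics of the K-integrand under `localGibbsMeasure σ a₀ u₀ θ₀ N` for ANY continuous profiles and any localised
  kernel `0 ≤ K ≤ C_K` of unit mass: `E|∫ₓ Σ Aᵢⱼ Gᵢⱼ| ≤ B C (√((N+1)⁻¹C_K) + (N+1)⁻¹C_K + δθ + δu²)` (δu, δθ = oscillation of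
  u₀, θ₀ on the kernel support), generalising E6 from constant profiles.
* G2 `FluxClosureEq.G2.kineticIsotropy_static_localGibbs` (p168796, `Theorems/…FluxClosureKinStaticLocalGibbs.lean`) —
  the cube-kernel corollary by uniform continuity: for EVERY local Gibbs law with continuous profiles and every ε,
  `E|∫ₓ Σ Aᵢⱼ Gᵢⱼ| ≤ B (C(((N+1)l³)^{-1/2} + ((N+1)l³)⁻¹) + ε)` for `l ≤ l₀(ε)`, uniformly in `N`.
  So flux-level kinetic local equilibrium is a THEOREM for every local equilibrium STATE; stub K is EXACTLY its
  propagation along the deterministic flow at positive times (true at t = 0 by G2, at all times in global equilibrium by E7).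
* MD falsifier (route card's "cheapest falsifier", never run before): `kit compute` jobs j026579 (validation: DONE, code validated —
  Enskog rates ±4 %, virial Z ±0.5 %, exact-balance residual 1e-3; virial normalisation of V consistent at 10 % at N_p = 8000),
  j027301–j027305 (N-scan N_p = 10³…10⁶) evaluate D_N, KinDev_N, CollDev_N VERBATIM along event-driven hard-sphere MD
  from local Gibbs data out of equilibrium (shear / compression / temperature waves + equilibrium control, two window
  families); evidence `MD-EVIDENCE.md` on the item when the jobs return (Enskog prediction: E|KinDev_N| ≈ c₁(N+1)^{-1/3}
  (viscous) + c₂((N+1)ℓ³)^{-1/2}; case C tests the virial normalisation ρθ(Z−1) of V, invisible to E7–E9).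

c2 (rung 0, all LANDED; namespace `…Theorems.FluxClosureEq.*`, files `Theorems/BoxDissipativeWeakStrongFluxClosureEq*.lean`):
* E8 `E8.fluxClosure_homogeneous` (p161000) — THE CRUX IN GLOBAL EQUILIBRIUM (constant profiles, homogeneous Gibbs law), in the
  crux's own frame, for every flow family and every kinetic window; from E1 `homogeneous_fineScale_allTimes` (p157774), E2
  `homogeneous_limitDefect_eq_zero` (p157791), E3/E4/E5 (p158149 / p158341 / p159184 (+p158587)), prelim p160134.
* E7 `E7.kineticIsotropy_homogeneous` (p159628) — stub K in global equilibrium, from E6 `kineticIsotropy_static_homogeneous`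
  (p158651 (+p158209)) + stationarity + Tonelli along the flow.  * E9 `E9.collisionalVirial_homogeneous` (p162386) — stub V in
  global equilibrium (E8 + E7 + the exact balance).  * FORMAT LEMMAS: UI p161956, W2m p162743, W2a p162694, W2b p162807,
  W2e p162735, W2d p162773 (the L¹(P_N) forms of K, V and of the crux FOLLOW from their in-probability forms).
c0/c1: planner birth skeleton (stubs B, K, V + glue); B reshaped into B1–B5, all LANDED (p148590 p148466 p148547 p148905 p148134),
exact split + glue LANDED (p150403); uniform L¹(P_N) tightness of K and V LANDED (p154219, p154797).

What remains open is exactly the NON-equilibrium positive-time content of K and V (flux-level local equilibrium of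
deterministic hard spheres at fixed reduced density: no theorem, no mixing input; Spohn1991 I §3.3, OVY93 need noise;
barrier `BoltzmannHypothesisBarrierNarrow` kernel (4)); V's tree-level gap = positive-time box concentration at the kinetic
window (field-side scale transfer from `CollisionIsometryCLT.CollisionalTransferLocality` (9518, itself being decomposed at block
scale (N+1)^{-γ}, γ ≤ 1/15) + rattler control above the band). Census files: `Cruxes/FluxClosure/K-census.md`, `CENSUS-c1.md`,
`CENSUS-c2.md`, `CENSUS-c3.md`.
-/

namespace Summit.AtomisticToContinuum.HydrodynamicLimit.Cruxes.FluxClosure.Birth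

open scoped BigOperators Topology Classical MeasureTheory ProbabilityTheory InnerProductSpace ENNReal
open Filter Set Function MeasureTheory
open Literature.MathematicalPhysics.KineticTheory Literature.Analysis.FluidPDE Literature.Analysis.FunctionSpaces
open Summit.AtomisticToContinuum.HydrodynamicLimit.Theses.BoxDissipativeWeakStrong

/-- stub K — KINETIC ISOTROPY (K1a; the hardest stub). In the crux's frame (EOS fact → `∃ η_c > 0`
`∀ 0 < η₁ < η_c` ∀ continuous positive profiles `∃ σ₀ > 0 ∀ 0 < σ < σ₀` ∀ classical hs-Euler solution
on `[0,T)` with `ρσ³ ≤ η₁/2` ∀ flow family with the `t = 0` LLN ∀ kinetic window `ℓ_N → 0`,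
`(N+1)ℓ_N³ → ∞`): for every `τ < T` and smooth `w`, the space–time average against `∇w` of the
TRACELESS box velocity covariance, `KinDev_N(z) = ∫_0^τ∫ Σᵢⱼ (S_kin − m̂⊗m̂/ρ̂ − δ ρ̂θ̂)ᵢⱼ ∂ⱼwᵢ`
(`S_kin = ∫ K vᵢvⱼ dμ_z`; its trace is fixed by `Ê`, so only the anisotropic part is claimed small),
tends to `0` in `L¹(P_N)`. Why plausibly true: local Maxwellians have isotropic second moments; the
claim is the flux-level (second-moment only) relaxation to local isotropy along the deterministic
dynamics at small fixed reduced density, integrated in space–time — the weakest form of local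
equilibrium any momentum closure needs. Why it might fail: no mixing theorem for deterministic
spheres (Spohn1991 §3.3; OVY93 need noise); a persistent shear anisotropy of box second moments at
kinetic windows would refute it. Size: open-problem. Leans on: `empiricalMeasure`,
`empiricalDensity/Momentum/EnergyField`, `localGibbsLaw`, `Torus.partialDeriv`, `HsEosLowDensity`. -/
theorem stub_kineticIsotropy : HsEosLowDensity → ∃ ηc : ℝ, 0 < ηc ∧ ∀ η₁ : ℝ, 0 < η₁ → η₁ < ηc → ∀ (a₀ θ₀ : T3 → ℝ) (u₀ : T3 → V3), Continuous a₀ → Continuous θ₀ → Continuous u₀ → (∀ x, 0 < a₀ x) → (∀ x, 0 < θ₀ x) → ∃ σ₀ : ℝ, 0 < σ₀ ∧ ∀ σ : ℝ, 0 < σ → σ < σ₀ → ∀ (T : ℝ) (ρ θ : ℝ → T3 → ℝ) (u : ℝ → T3 → V3), IsHardSphereEulerSolution σ T ρ u θ → (∀ t ∈ Ico 0 T, ∀ x, ρ t x * σ ^ 3 ≤ η₁ / 2) → ∀ Φ : (N : ℕ) → HardSphereFlow (Torus.geometry (Fin 3)) (hsDiameter σ N) (N + 1), TendstoHydroFieldsAt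 (fun N => localGibbsLaw σ a₀ u₀ θ₀ N (Φ N)) Φ ρ u θ 0 → ∀ ℓ : ℕ → ℝ, (∀ N, 0 < ℓ N ∧ ℓ N ≤ 1) → Tendsto ℓ atTop (𝓝 0) → Tendsto (fun N : ℕ => ℓ N ^ 3 * ((N : ℝ) + 1)) atTop atTop → let K := fun (l : ℝ) (x y : T3) => indicator {y' : T3 | ∀ i, ‖y' i - x i‖ < l / 2} (fun _ => (l ^ 3)⁻¹) y; let Dn := fun N t z x => empiricalDensityField ((Φ N).flow t z) (K (ℓ N) x); let Mm := fun N t z x => empiricalMomentumField ((Φ N).flow t z) (K (ℓ N) x); let En := fun N t z x => empiricalEnergyField ((Φ N).flow t z) (K (ℓ N) x); let Sk := fun N t z x (i j : Fin 3) => ∫ y, K (ℓ N) x y.1 * (y.2 i * y.2 j) ∂(empiricalMeasure ((Φ N).flow t z)); let Th := fun (r : ℝ) (m : V3) (E : ℝ) => 2 / 3 * (E / r - ‖m‖ ^ 2 / (2 * r ^ 2)); ∀ τ ∈ Ico 0 T, ∀ w : ℝ → T3 → V3, Torus.IsSmoothSpaceTimeOn (Ico 0 T) w → Tendsto (fun N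 : ℕ => ∫⁻ z, ENNReal.ofReal (|∫ t in Ioc 0 τ, ∫ x, ∑ i, ∑ j, (Sk N t z x i j - Mm N t z x i * Mm N t z x j / Dn N t z x - (if i = j then Dn N t z x * Th (Dn N t z x) (Mm N t z x) (En N t z x) else 0)) * Torus.partialDeriv j (fun y => w t y i) x|) ∂(localGibbsLaw σ a₀ u₀ θ₀ N (Φ N))) atTop (𝓝 0) := by
  sorry

/-- stub V — COLLISIONAL VIRIAL (K1b). In the same frame: for every `τ < T` and smooth `w`, the
time-integrated collisional momentum transfer tested against the box average of `w`,
`C_w(z) = Σ_{t_c ∈ (0,τ]} jump of (N+1)⁻¹ Σᵢ ⟪∫ K(ℓ_N,x,qᵢ) w(t_c,x) dx, vᵢ⟫` (prelude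
`collisionJump`/`collisionTimes`/`momentumObservable` along the orbit `s ↦ Φ_s z`), closes on the
CUT EXCESS PRESSURE: `C_w(z) − ∫_0^τ∫ ρ̂θ̂ (Z(min(ρ̂σ³, η₁)) − 1) div w → 0` in `L¹(P_N)`
(`θ̂ = ⅔(Ê/ρ̂ − |m̂|²/2ρ̂²)`, `Z = hsCompressibility`). Why plausibly true: at a binary contact the
jump is `⟪(K⋆w)(qᵢ) − (K⋆w)(qⱼ), Δvᵢ⟫ ≈ ε (n·∇)(K⋆w)·Δvᵢ`, and the contact-value virial theorem
(Spohn1991 I (3.15): collision rate × mean momentum transfer = `ρθ(Z(ρσ³) − 1)`) identifies its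
space–time average in local equilibrium below the band; the bet (the crux's own why-might-fail) is
that boxes above the band `η₁`, where the cut freezes `Z`, are flux-negligible although jammed
pockets carry a rattler pressure. Why it might fail: that rattler pressure, or persistent
pre-collisional correlations (no Boltzmann-hypothesis substitute at fixed density) biasing the
contact statistics away from the local-equilibrium pair correlation at contact. Size: open-problem.
Leans on: `collisionJump`, `collisionTimes`, `momentumObservable`, `hsCompressibility`,
`empirical*Field`, `localGibbsLaw`, `Torus.divergence`, `HsEosLowDensity`. -/
theorem stub_collisionalVirial : HsEosLowDensity → ∃ ηc : ℝ, 0 < ηc ∧ ∀ η₁ : ℝ, 0 < η₁ → η₁ < ηc → ∀ (a₀ θ₀ : T3 → ℝ) (u₀ : T3 → V3), Continuous a₀ → Continuous θ₀ → Continuous u₀ → (∀ x, 0 < a₀ x) → (∀ x, 0 < θ₀ x) → ∃ σ₀ : ℝ, 0 < σ₀ ∧ ∀ σ : ℝ, 0 < σ → σ < σ₀ → ∀ (T : ℝ) (ρ θ : ℝ → T3 → ℝ) (u : ℝ → T3 → V3), IsHardSphereEulerSolution σ T ρ u θ → (∀ t ∈ Ico 0 T, ∀ x, ρ t x * σ ^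 3 ≤ η₁ / 2) → ∀ Φ : (N : ℕ) → HardSphereFlow (Torus.geometry (Fin 3)) (hsDiameter σ N) (N + 1), TendstoHydroFieldsAt (fun N => localGibbsLaw σ a₀ u₀ θ₀ N (Φ N)) Φ ρ u θ 0 → ∀ ℓ : ℕ → ℝ, (∀ N, 0 < ℓ N ∧ ℓ N ≤ 1) → Tendsto ℓ atTop (𝓝 0) → Tendsto (fun N : ℕ => ℓ N ^ 3 * ((N : ℝ) + 1)) atTop atTop → let K := fun (l : ℝ) (x y : T3) => indicator {y' : T3 | ∀ i, ‖y' i - x i‖ < l / 2} (fun _ => (l ^ 3)⁻¹) y; let Dn := fun N t z x => empiricalDensityField ((Φ N).flow t z) (K (ℓ N) x); let Mm := fun N t z x => empiricalMomentumField ((Φ N).flow t z) (K (ℓ N) x); let En := fun N t z x => empiricalEnergyField ((Φ N).flow t z) (K (ℓ N) x); let Th := fun (r : ℝ) (m : V3) (E : ℝ) => 2 / 3 * (E / r - ‖m‖ ^ 2 / (2 * r ^ 2)); let Zc := fun η : ℝ => hsCompressibility (min η η₁); ∀ τ ∈ Ico 0 T, ∀ w : ℝ → T3 → V3, Torus.IsSmoothSpaceTimeOn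 (Ico 0 T) w → let Cw := fun N (z : Config (N + 1) (Fin 3) T3) => ∑ᶠ t ∈ collisionTimes (Torus.geometry (Fin 3)) (hsDiameter σ N) (fun s => (Φ N).flow s z) ∩ Ioc 0 τ, collisionJump (fun z' : Config (N + 1) (Fin 3) T3 => ((N : ℝ) + 1)⁻¹ * momentumObservable (fun q => ∫ x, K (ℓ N) x q • w t x) z') (fun s => (Φ N).flow s z) t; Tendsto (fun N : ℕ => ∫⁻ z, ENNReal.ofReal (|Cw N z - ∫ t in Ioc 0 τ, ∫ x, Dn N t z x * Th (Dn N t z x) (Mm N t z x) (En N t z x) * (Zc (Dn N t z x * σ ^ 3) - 1) * Torus.divergence (w t) x|) ∂(localGibbsLaw σ a₀ u₀ θ₀ N (Φ N))) atTop (𝓝 0) := by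
  sorry

/-- THE SKELETON THEOREM (A12 layer invariant): concludes the crux `FluxClosure` BY NAME with no hypotheses,
from the two registered open stubs through the LANDED glue `FluxClosureGlue.stub_fluxClosureOfLimitStubs`
(p150403); its only `sorryAx` dependence is through `stub_kineticIsotropy` / `stub_collisionalVirial`. When
both land (`propose --supports stmt-AtomisticToContinuum-9902`, by name + signature) this file with the stubs
replaced by the landed theorems is the crux proof. -/
theorem FluxClosure_of : FluxClosure :=
  Summit.AtomisticToContinuum.HydrodynamicLimit.Theorems.FluxClosureGlue.stub_fluxClosureOfLimitStubs
    stub_kineticIsotropy stub_collisionalVirial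

end Summit.AtomisticToContinuum.HydrodynamicLimit.Cruxes.FluxClosure.Birth
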